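import Literature.Analysis.FluidPDE.KatoLaiTorusOperatorLipschitz
import Literature.Analysis.FunctionSpaces.TorusSymL2Weak
import Literature.Analysis.FunctionSpaces.TorusSobolevNormEmbeddingProofs
import HarnessLib

/-!
# Kato–Lai's operator on the weighted lattice space `SymL2`: extension by truncation limits

Analysis/FluidPDE support file for the energy-method construction of Euler flows in the
periodic cylinder (`Literature.Analysis.FluidPDE.KatoLai1984_periodicCylinderUniformExistence`;
Kato–Lai 1984, §5: `A` maps `H = H^s` into `H^{s−1} ⊂ H⁰ = X` weakly continuously, with the
compressed norms (5.2) `(u | v)_{s₀} + ε² (u | v)_s`). The Hilbert space `H` of the abstract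
existence theorem: the real `ℓ²` space `SymL2 (Fin 3)` of conjugation-symmetric families
(`TorusSymL2`), an element `f` storing `w(k) û(k)` for the **compressed weight**

  `w(k)² = klWeight s ε k ² = (1 + ∑ᵢ (2π kᵢ)⁶) + ε² (1 + ∑ᵢ (2π kᵢ)^{2s})`

(pure weights, so that `‖f‖² = ‖u‖²_{H⁰} + ∑ᵢ ‖∂ᵢ³ u‖² + ε² (…)` exactly by Plancherel).

* `klWeight`, `isWeight_klWeight`, `polyGrowth_klWeight`, `latWeight_three_le_klWeight_sq`,
  `summable_klWeight_inv_sq` — the weight and its comparison with `(1 + |k|²)³`;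
* `h2Symbol w k = (1 + |k|²)/w(k)` — bounded, even, **vanishing at infinity**; for smooth `U`,
  `lat₂(U) = ‖diag h2Symbol (ofSmooth w U)‖²`, `lat₃(U) ≤ 16 ‖ofSmooth w U‖²`;
* `truncField w N f` — the real trigonometric polynomial with the physical coefficients of `f`
  on the frequency ball (`= field w (trunc N f)`), smooth, `ofSmooth w (truncField N f) = trunc N f`;
* `klOpApprox N f = ofSmooth 1 (klOp (truncField N f))`, **Cauchy** in `SymL2` by the Lipschitz
  bound of `KatoLaiTorusOperatorLipschitz`, and **the extended operator**
  `klOpExt f = lim_N klOpApprox N f`;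
* `klOpExt_ofSmooth` (**(E1)** on smooth fields it is `ofSmooth 1 (klOp U)`),
  `exists_norm_klOpExt_sub_le` (**(E2)** local Lipschitz by `‖diag h2Symbol (f − g)‖`),
  `tendsto_klOpExt_of_weakTendsto` (**(E3)** weakly convergent sequences are mapped to norm
  convergent ones — Kato–Lai's "weak convergence in `H^{s₀−1}` implies local uniform convergence").

Everything is proved; no named fact and no `sorry` is introduced.

## References

* T. Kato, C. Y. Lai, J. Funct. Anal. 56 (1984) 15–28, §5 (5.1)–(5.6). [KatoLai1984]
-/

noncomputable section

open MeasureTheory Set Function Filter Topology TopologicalSpace Finset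
open scoped NNReal ENNReal InnerProductSpace RealInnerProductSpace

namespace Literature.Analysis.FluidPDE

open FunctionSpaces FunctionSpaces.Torus UnitAddTorus

/-- Local notation for physical space `ℝ³ = EuclideanSpace ℝ (Fin 3)`. -/
local notation "ℝ³" => EuclideanSpace ℝ (Fin 3)

namespace PeriodicCylinder

/-! ### The compressed weight -/

/-- The squared pure weight of level `m`: `1 + ∑ᵢ (2π |kᵢ|)^{2m}`. [cite: KatoLai1984, §5 (5.2)] -/
def pureSq (m : ℕ) (k : Fin 3 → ℤ) : ℝ := 1 + ∑ i, ((2 * Real.pi * |(k i : ℝ)|) ^ m) ^ 2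

/-- `pureSq m k ≥ 1`. [folklore] -/
theorem one_le_pureSq (m : ℕ) (k : Fin 3 → ℤ) : 1 ≤ pureSq m k := by
  unfold pureSq
  have : 0 ≤ ∑ i, ((2 * Real.pi * |(k i : ℝ)|) ^ m) ^ 2 := sum_nonneg fun _ _ => sq_nonneg _
  linarith

/-- `pureSq` is even. [folklore] -/
theorem pureSq_neg (m : ℕ) (k : Fin 3 → ℤ) : pureSq m (-k) = pureSq m k := by
  simp [pureSq]

/-- `(1 + |k|²)^m ≤ 4^{m-1} pureSq m k` for `m ≥ 1`. [folklore] -/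
theorem latWeight_le_pureSq (k : Fin 3 → ℤ) {m : ℕ} (hm : 1 ≤ m) : (1 + freqNormSq k) ^ m ≤ 4 ^ (m - 1) * pureSq m k := by
  have h := GalerkinSmooth.weight_pow_le_pureWeight k hm
  have hc : ((Fintype.card (Fin 3) : ℝ) + 1) = 4 := by norm_num
  rw [hc] at h
  exact h

/-- `pureSq m k ≤ (1 + 3 (2π)^{2m}) (1 + |k|²)^m`. [folklore] -/
theorem pureSq_le_latWeight (k : Fin 3 → ℤ) (m : ℕ) : pureSq m k ≤ (1 + 3 * (2 * Real.pi) ^ (2 * m)) * (1 + freqNormSq k) ^ m := by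
  have h := GalerkinSmooth.pureWeight_le_weight_pow k m
  have hc : (Fintype.card (Fin 3) : ℝ) = 3 := by norm_num
  rw [hc] at h
  exact h

/-- **The compressed weight** between levels `3` and `s`:
`w(k) = (pureSq 3 k + ε² pureSq s k)^{1/2}`. [cite: KatoLai1984, §5 (5.2)] -/
def klWeight (s : ℕ) (ε : ℝ) (k : Fin 3 → ℤ) : ℝ := Real.sqrt (pureSq 3 k + ε ^ 2 * pureSq s k)

/-- The radicand is `≥ 1`. [folklore] -/
theorem one_le_klWeight_radicand (s : ℕ) (ε : ℝ) (k : Fin 3 → ℤ) : 1 ≤ pureSq 3 k + ε ^ 2 * pureSq s k := by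
  have h1 := one_le_pureSq 3 k
  have h2 : 0 ≤ ε ^ 2 * pureSq s k := mul_nonneg (sq_nonneg _) (zero_le_one.trans (one_le_pureSq s k))
  linarith

/-- `w(k)² = pureSq 3 k + ε² pureSq s k`. [folklore] -/
theorem klWeight_sq (s : ℕ) (ε : ℝ) (k : Fin 3 → ℤ) : klWeight s ε k ^ 2 = pureSq 3 k + ε ^ 2 * pureSq s k :=
  Real.sq_sqrt (zero_le_one.trans (one_le_klWeight_radicand s ε k))

/-- `w(k) ≥ 1`. [folklore] -/
theorem one_le_klWeight (s : ℕ) (ε : ℝ) (k : Fin 3 → ℤ) : 1 ≤ klWeight s ε k := by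
  rw [klWeight, ← Real.sqrt_one]
  exact Real.sqrt_le_sqrt (one_le_klWeight_radicand s ε k)

/-- `w(k) > 0`. [folklore] -/
theorem klWeight_pos (s : ℕ) (ε : ℝ) (k : Fin 3 → ℤ) : 0 < klWeight s ε k := lt_of_lt_of_le one_pos (one_le_klWeight s ε k)

/-- The compressed weight is a weight (positive, even). [folklore] -/
theorem isWeight_klWeight (s : ℕ) (ε : ℝ) : SymL2.IsWeight (klWeight s ε) :=
  ⟨klWeight_pos s ε, fun k => by rw [klWeight, klWeight, pureSq_neg, pureSq_neg]⟩

/-- The compressed weight has polynomial growth. [folklore] -/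
theorem polyGrowth_klWeight (s : ℕ) (ε : ℝ) : SymL2.PolyGrowth (klWeight s ε) := by
  refine ⟨(1 + 3 * (2 * Real.pi) ^ (2 * 3)) + ε ^ 2 * (1 + 3 * (2 * Real.pi) ^ (2 * s)), 3 + s, fun k => ?_⟩
  have hk1 : (1 : ℝ) ≤ 1 + freqNormSq k := by linarith [freqNormSq_nonneg k]
  rw [abs_of_pos (klWeight_pos s ε k)]
  have hw : klWeight s ε k ≤ klWeight s ε k ^ 2 := by
    have h1 := one_le_klWeight s ε k
    nlinarith
  refine hw.trans ?_
  rw [klWeight_sq]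
  have e3 := pureSq_le_latWeight k 3
  have es := pureSq_le_latWeight k s
  have h3 : (1 + freqNormSq k) ^ 3 ≤ (1 + freqNormSq k) ^ (3 + s) := pow_le_pow_right₀ hk1 (by omega)
  have hs : (1 + freqNormSq k) ^ s ≤ (1 + freqNormSq k) ^ (3 + s) := pow_le_pow_right₀ hk1 (by omega)
  have hε : 0 ≤ ε ^ 2 := sq_nonneg _
  calc pureSq 3 k + ε ^ 2 * pureSq s k
      ≤ (1 + 3 * (2 * Real.pi) ^ (2 * 3)) * (1 + freqNormSq k) ^ (3 + s) +
          ε ^ 2 * ((1 + 3 * (2 * Real.pi) ^ (2 * s)) * (1 + freqNormSq k) ^ (3 + s)) :=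
        add_le_add (e3.trans (mul_le_mul_of_nonneg_left h3 (by positivity)))
          (mul_le_mul_of_nonneg_left (es.trans (mul_le_mul_of_nonneg_left hs (by positivity))) hε)
    _ = _ := by ring

/-- **The comparison with `(1 + |k|²)³`**: `(1 + |k|²)³ ≤ 16 w(k)²`. [folklore] -/
theorem latWeight_three_le_klWeight_sq (s : ℕ) (ε : ℝ) (k : Fin 3 → ℤ) :
    (1 + freqNormSq k) ^ 3 ≤ 16 * klWeight s ε k ^ 2 := by
  rw [klWeight_sq]
  have h := latWeight_le_pureSq k (m := 3) (by norm_num)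
  norm_num at h
  have h2 : 0 ≤ ε ^ 2 * pureSq s k := mul_nonneg (sq_nonneg _) (zero_le_one.trans (one_le_pureSq s k))
  linarith

/-- `ε² (1 + |k|²)^s ≤ 4^{s-1} w(k)²` for `s ≥ 1`. [folklore] -/
theorem sq_mul_latWeight_le_klWeight_sq {s : ℕ} (hs : 1 ≤ s) (ε : ℝ) (k : Fin 3 → ℤ) :
    ε ^ 2 * (1 + freqNormSq k) ^ s ≤ 4 ^ (s - 1) * klWeight s ε k ^ 2 := by
  rw [klWeight_sq]
  have h := latWeight_le_pureSq k hs
  have h1 : 0 ≤ pureSq 3 k := zero_le_one.trans (one_le_pureSq 3 k)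
  have h4 : (1 : ℝ) ≤ 4 ^ (s - 1) := one_le_pow₀ (by norm_num)
  calc ε ^ 2 * (1 + freqNormSq k) ^ s ≤ ε ^ 2 * (4 ^ (s - 1) * pureSq s k) := mul_le_mul_of_nonneg_left h (sq_nonneg _)
    _ = 4 ^ (s - 1) * (ε ^ 2 * pureSq s k) := by ring
    _ ≤ 4 ^ (s - 1) * (pureSq 3 k + ε ^ 2 * pureSq s k) := by
        refine mul_le_mul_of_nonneg_left ?_ (by positivity)
        linarith

/-- `∑ w(k)⁻² < ∞`. [folklore] -/
theorem summable_klWeight_inv_sq (s : ℕ) (ε : ℝ) : Summable fun k : Fin 3 → ℤ => (klWeight s ε k)⁻¹ ^ 2 := by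
  have h := summable_one_add_freqNormSq_rpow_neg_of_lt (d := Fin 3) (s := 3) (by norm_num)
  refine (h.mul_left 16).of_nonneg_of_le (fun k => sq_nonneg _) fun k => ?_
  have hw := latWeight_three_le_klWeight_sq s ε k
  have hpos : 0 < (1 + freqNormSq k) ^ 3 := pow_pos (by linarith [freqNormSq_nonneg k]) 3
  have hwpos := klWeight_pos s ε k
  rw [Real.rpow_neg (by linarith [freqNormSq_nonneg k]), show ((3 : ℝ)) = ((3 : ℕ) : ℝ) by norm_num, Real.rpow_natCast,
    inv_pow]
  rw [inv_le_comm₀ (pow_pos hwpos 2) (by positivity), mul_inv, inv_inv]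
  calc 16⁻¹ * (1 + freqNormSq k) ^ 3 ≤ 16⁻¹ * (16 * klWeight s ε k ^ 2) := mul_le_mul_of_nonneg_left hw (by norm_num)
    _ = klWeight s ε k ^ 2 := by ring

/-! ### The `H²` control symbol -/

/-- The symbol `(1 + |k|²)/w(k)` carrying `lat₂` of the physical field. [folklore] -/
def h2Symbol (s : ℕ) (ε : ℝ) (k : Fin 3 → ℤ) : ℝ := (1 + freqNormSq k) * (klWeight s ε k)⁻¹

/-- `0 < h2Symbol`. [folklore] -/
theorem h2Symbol_pos (s : ℕ) (ε : ℝ) (k : Fin 3 → ℤ) : 0 < h2Symbol s ε k :=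
  mul_pos (by linarith [freqNormSq_nonneg k]) (inv_pos.2 (klWeight_pos s ε k))

/-- `|h2Symbol| ≤ 4`. [folklore] -/
theorem abs_h2Symbol_le (s : ℕ) (ε : ℝ) (k : Fin 3 → ℤ) : |h2Symbol s ε k| ≤ 4 := by
  rw [abs_of_pos (h2Symbol_pos s ε k)]
  have hw := latWeight_three_le_klWeight_sq s ε k
  have hk1 : (1 : ℝ) ≤ 1 + freqNormSq k := by linarith [freqNormSq_nonneg k]
  have hwpos := klWeight_pos s ε k
  -- `(1+|k|²)² ≤ (1+|k|²)³ ≤ 16 w²`, so `(1+|k|²) ≤ 4 w`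
  have h2 : (1 + freqNormSq k) ^ 2 ≤ (4 * klWeight s ε k) ^ 2 := by
    calc (1 + freqNormSq k) ^ 2 ≤ (1 + freqNormSq k) ^ 3 := pow_le_pow_right₀ hk1 (by norm_num)
      _ ≤ 16 * klWeight s ε k ^ 2 := hw
      _ = (4 * klWeight s ε k) ^ 2 := by ring
  have h3 : 1 + freqNormSq k ≤ 4 * klWeight s ε k := (pow_le_pow_iff_left₀ (by positivity) (by positivity) two_ne_zero).1 h2
  rw [h2Symbol, mul_inv_le_iff₀ hwpos]
  linarith

/-- `h2Symbol` is even. [folklore] -/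
theorem h2Symbol_neg (s : ℕ) (ε : ℝ) (k : Fin 3 → ℤ) : h2Symbol s ε (-k) = h2Symbol s ε k := by
  rw [h2Symbol, h2Symbol, freqNormSq_neg, (isWeight_klWeight s ε).even]

/-- **`h2Symbol` vanishes at infinity** (`≤ 4 (1+|k|²)^{-1/2}`). [folklore] -/
theorem vanishingSymbol_h2Symbol (s : ℕ) (ε : ℝ) : SymL2.VanishingSymbol (h2Symbol s ε) := by
  intro δ hδ
  -- choose `N` with `16/(1+N²) ≤ δ²`
  obtain ⟨N, hN⟩ := exists_nat_gt (16 / δ ^ 2)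
  refine ⟨N, fun k hk => ?_⟩
  rw [mem_freqBall, not_le] at hk
  rw [abs_of_pos (h2Symbol_pos s ε k)]
  have hwpos := klWeight_pos s ε k
  have hk1 : (1 : ℝ) ≤ 1 + freqNormSq k := by linarith [freqNormSq_nonneg k]
  have hw := latWeight_three_le_klWeight_sq s ε k
  -- `h2Symbol² = (1+|k|²)² / w² ≤ 16/(1+|k|²) < 16/N² < δ²`
  have hsq : h2Symbol s ε k ^ 2 ≤ 16 / (1 + freqNormSq k) := by
    rw [h2Symbol, mul_pow, inv_pow, le_div_iff₀ (by linarith), ← div_eq_mul_inv, div_mul_eq_mul_div,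
      div_le_iff₀ (pow_pos hwpos 2)]
    nlinarith
  have hlt : 16 / (1 + freqNormSq k) < δ ^ 2 := by
    rw [div_lt_iff₀ (by linarith)]
    have hN' : 16 / δ ^ 2 < 1 + freqNormSq k := by
      have : (N : ℝ) ^ 2 < freqNormSq k := hk
      have hN0 : (0 : ℝ) ≤ N := Nat.cast_nonneg N
      nlinarith
    rwa [div_lt_iff₀ (by positivity), mul_comm] at hN'
  have := hsq.trans_lt hlt
  exact ((pow_lt_pow_iff_left₀ (h2Symbol_pos s ε k).le hδ.le two_ne_zero).1 this).le

/-! ### `ofSmooth` of a difference -/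

/-- `ofSmooth w (u − v) = ofSmooth w u − ofSmooth w v`. [folklore] -/
theorem ofSmooth_fun_sub {w : (Fin 3 → ℤ) → ℝ} (hw : SymL2.IsWeight w) (hpg : SymL2.PolyGrowth w)
    {u v : UnitAddTorus (Fin 3) → ℝ³} (hu : IsSmooth u) (hv : IsSmooth v) :
    SymL2.ofSmooth w hw hpg (fun x => u x - v x) (hu.sub hv) = SymL2.ofSmooth w hw hpg u hu - SymL2.ofSmooth w hw hpg v hv := by
  refine SymL2.ext fun k => ?_
  rw [SymL2.sub_apply, SymL2.ofSmooth_apply, SymL2.ofSmooth_apply, SymL2.ofSmooth_apply, ← smul_sub]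
  congr 1
  have : (EuclideanSpace.complexify ∘ fun x => u x - v x) = (EuclideanSpace.complexify ∘ u) - (EuclideanSpace.complexify ∘ v) := by
    funext y; simp [map_sub]
  rw [this, mFourierCoeff_sub (integrable_complexify_comp hu.integrable) (integrable_complexify_comp hv.integrable)]

/-! ### Lattice energies of smooth fields through `SymL2` -/

section Smooth

variable (s : ℕ) (ε : ℝ) {U : UnitAddTorus (Fin 3) → ℝ³} (hU : IsSmooth U)

/-- The `SymL2` element of a smooth field at the compressed weight. [folklore] -/
abbrev toSym (hU : IsSmooth U) : SymL2 (Fin 3) :=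
  SymL2.ofSmooth (klWeight s ε) (isWeight_klWeight s ε) (polyGrowth_klWeight s ε) U hU

/-- **`lat₃(U) ≤ 16 ‖toSym U‖²`.** [folklore] -/
theorem latNormSq_three_le_norm_toSym_sq : Torus.latNormSq 3 U ≤ 16 * ‖toSym s ε hU‖ ^ 2 := by
  have h := SymL2.hasSum_norm_sq_ofSmooth (isWeight_klWeight s ε) (polyGrowth_klWeight s ε) hU
  unfold Torus.latNormSq
  rw [← (h.mul_left 16).tsum_eq]
  refine (Torus.summable_latWeight hU 3).tsum_le_tsum (fun k => ?_) ((h.mul_left 16).summable)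
  rw [← mul_assoc]
  exact mul_le_mul_of_nonneg_right (latWeight_three_le_klWeight_sq s ε k) (sq_nonneg _)

/-- **`lat₂(U) = ‖diag h2Symbol (toSym U)‖²`.** [folklore] -/
theorem latNormSq_two_eq_norm_diag_sq :
    Torus.latNormSq 2 U = ‖SymL2.diag (h2Symbol s ε) (abs_h2Symbol_le s ε) (h2Symbol_neg s ε) (toSym s ε hU)‖ ^ 2 := by
  have h := SymL2.hasSum_norm_sq_diag (h2Symbol s ε) (abs_h2Symbol_le s ε) (h2Symbol_neg s ε) (toSym s ε hU)
  unfold Torus.latNormSq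
  rw [← h.tsum_eq]
  refine tsum_congr fun k => ?_
  have hw := (klWeight_pos s ε k).ne'
  simp only [SymL2.ofSmooth_apply, norm_smul, Complex.norm_real, Real.norm_of_nonneg (klWeight_pos s ε k).le, h2Symbol]
  field_simp

end Smooth

/-! ### The truncated physical field -/

section Trunc

variable (s : ℕ) (ε : ℝ)

/-- **The truncated physical field** of `f`: the real trigonometric polynomial with the physical
coefficients `w(k)⁻¹ f k` on the frequency ball of radius `N`. [folklore] -/
def truncField (N : ℕ) (f : SymL2 (Fin 3)) : UnitAddTorus (Fin 3) → ℝ³ :=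
  realTrigPoly (freqBall N) (SymL2.coef (klWeight s ε) f)

/-- The truncated field is smooth. [folklore] -/
theorem isSmooth_truncField (N : ℕ) (f : SymL2 (Fin 3)) : IsSmooth (truncField s ε N f) := isSmooth_realTrigPoly _ _

/-- The Fourier coefficients of the truncated field. [folklore] -/
theorem mFourierCoeff_truncField (N : ℕ) (f : SymL2 (Fin 3)) (k : Fin 3 → ℤ) :
    mFourierCoeff (EuclideanSpace.complexify ∘ truncField s ε N f) k =
      if k ∈ freqBall N then SymL2.coef (klWeight s ε) f k else 0 :=
  mFourierCoeff_realTrigPoly neg_mem_freqBall_of_mem (SymL2.isConjSymm_coef (isWeight_klWeight s ε) f) k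

/-- **`toSym (truncField N f) = trunc N f`.** [folklore] -/
theorem toSym_truncField (N : ℕ) (f : SymL2 (Fin 3)) : toSym s ε (isSmooth_truncField s ε N f) = SymL2.trunc N f := by
  refine SymL2.ext fun k => ?_
  rw [SymL2.ofSmooth_apply, mFourierCoeff_truncField, SymL2.trunc_apply]
  split_ifs with hk
  · exact SymL2.smul_coef (isWeight_klWeight s ε) f k
  · simp

/-- The truncated field is linear: differences. [folklore] -/
theorem truncField_sub (N : ℕ) (f g : SymL2 (Fin 3)) :
    truncField s ε N (f - g) = fun ξ => truncField s ε N f ξ - truncField s ε N g ξ := by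
  funext ξ
  simp only [truncField, realTrigPoly_apply, trigPoly_apply]
  have hc : ∀ k, SymL2.coef (klWeight s ε) (f - g) k = SymL2.coef (klWeight s ε) f k - SymL2.coef (klWeight s ε) g k :=
    fun k => by simp only [SymL2.coef_apply, SymL2.sub_apply, smul_sub]
  simp only [hc, smul_sub, sum_sub_distrib, map_sub]

/-- `lat₂` of a difference of truncated fields. [folklore] -/
theorem latNormSq_two_truncField_sub (N : ℕ) (f g : SymL2 (Fin 3)) :
    Torus.latNormSq 2 (fun ξ => truncField s ε N f ξ - truncField s ε N g ξ) =
      ‖SymL2.diag (h2Symbol s ε) (abs_h2Symbol_le s ε) (h2Symbol_neg s ε) (SymL2.trunc N (f - g))‖ ^ 2 := by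
  have h := latNormSq_two_eq_norm_diag_sq s ε (isSmooth_truncField s ε N (f - g))
  rw [toSym_truncField] at h
  rw [← truncField_sub]
  exact h

/-- `lat₃` of a truncated field: `≤ 16 ‖f‖²`. [folklore] -/
theorem latNormSq_three_truncField_le (N : ℕ) (f : SymL2 (Fin 3)) : Torus.latNormSq 3 (truncField s ε N f) ≤ 16 * ‖f‖ ^ 2 := by
  have h := latNormSq_three_le_norm_toSym_sq s ε (isSmooth_truncField s ε N f)
  rw [toSym_truncField] at h
  exact h.trans (mul_le_mul_of_nonneg_left (pow_le_pow_left₀ (norm_nonneg _) (SymL2.norm_trunc_le N f) 2) (by norm_num))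

/-- `‖diag h2 (trunc N g)‖ ≤ ‖diag h2 g‖`: truncation commutes with multipliers and contracts. [folklore] -/
theorem norm_diag_trunc_le (N : ℕ) (g : SymL2 (Fin 3)) :
    ‖SymL2.diag (h2Symbol s ε) (abs_h2Symbol_le s ε) (h2Symbol_neg s ε) (SymL2.trunc N g)‖ ≤
      ‖SymL2.diag (h2Symbol s ε) (abs_h2Symbol_le s ε) (h2Symbol_neg s ε) g‖ := by
  have hcomm : SymL2.diag (h2Symbol s ε) (abs_h2Symbol_le s ε) (h2Symbol_neg s ε) (SymL2.trunc N g) =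
      SymL2.trunc N (SymL2.diag (h2Symbol s ε) (abs_h2Symbol_le s ε) (h2Symbol_neg s ε) g) := by
    refine SymL2.ext fun k => ?_
    simp only [SymL2.diag_apply, SymL2.trunc_apply]
    split_ifs <;> simp
  rw [hcomm]
  exact SymL2.norm_trunc_le N _

end Trunc

/-! ### The approximants and the extended operator -/

section Ext

variable {L : ℝ} (hL : 0 < L) (s : ℕ) (ε : ℝ)

/-- The unit weight. [folklore] -/
theorem isWeight_one : SymL2.IsWeight (fun _ : Fin 3 → ℤ => (1 : ℝ)) := ⟨fun _ => one_pos, fun _ => rfl⟩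

/-- The unit weight has polynomial growth. [folklore] -/
theorem polyGrowth_one : SymL2.PolyGrowth (fun _ : Fin 3 → ℤ => (1 : ℝ)) :=
  ⟨1, 0, fun k => by simp⟩

/-- The `L²`-level element of a smooth field: stores `û(k)`. [folklore] -/
abbrev toL2 {V : UnitAddTorus (Fin 3) → ℝ³} (hV : IsSmooth V) : SymL2 (Fin 3) :=
  SymL2.ofSmooth (fun _ => (1 : ℝ)) isWeight_one polyGrowth_one V hV

/-- **`‖toL2 V‖² = lat₀(V) = ∫ ‖V‖²`.** [folklore] -/
theorem norm_toL2_sq {V : UnitAddTorus (Fin 3) → ℝ³} (hV : IsSmooth V) : ‖toL2 hV‖ ^ 2 = Torus.latNormSq 0 V := by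
  have h := SymL2.hasSum_norm_sq_ofSmooth isWeight_one polyGrowth_one hV
  simp only [one_pow, one_mul] at h
  unfold Torus.latNormSq
  simp only [pow_zero, one_mul]
  exact h.tsum_eq.symm

/-- `toL2` of a difference. [folklore] -/
theorem toL2_sub {V V' : UnitAddTorus (Fin 3) → ℝ³} (hV : IsSmooth V) (hV' : IsSmooth V') :
    toL2 (hV.sub hV') = toL2 hV - toL2 hV' :=
  ofSmooth_fun_sub isWeight_one polyGrowth_one hV hV' 

/-- **`‖toL2 V − toL2 V'‖² = ∫ ‖V − V'‖²`.** [folklore] -/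
theorem norm_toL2_sub_sq {V V' : UnitAddTorus (Fin 3) → ℝ³} (hV : IsSmooth V) (hV' : IsSmooth V') :
    ‖toL2 hV - toL2 hV'‖ ^ 2 = ∫ ξ, ‖V ξ - V' ξ‖ ^ 2 := by
  rw [← toL2_sub, norm_toL2_sq, Torus.latNormSq_zero (hV.sub hV')]
  rfl

/-- **The approximants** `𝒜̂_N f = toL2 (klOp (truncField N f))`. [cite: KatoLai1984, §5 (5.6)] -/
def klOpApprox (N : ℕ) (f : SymL2 (Fin 3)) : SymL2 (Fin 3) :=
  toL2 (isSmooth_klOp hL (isSmooth_truncField s ε N f))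

/-- **The Cauchy/Lipschitz estimate of the approximants**: for `‖f‖, ‖g‖ ≤ ρ`,
`‖𝒜̂_N f − 𝒜̂_M g‖² ≤ C_ρ ‖diag h2 (trunc N f − trunc M g)‖²`. [folklore] -/
theorem exists_norm_klOpApprox_sub_sq_le (ρ : ℝ) : ∃ C : ℝ, 0 ≤ C ∧
    ∀ (N M : ℕ) (f g : SymL2 (Fin 3)), ‖f‖ ≤ ρ → ‖g‖ ≤ ρ →
      ‖klOpApprox hL s ε N f - klOpApprox hL s ε M g‖ ^ 2 ≤
        C * ‖SymL2.diag (h2Symbol s ε) (abs_h2Symbol_le s ε) (h2Symbol_neg s ε) (SymL2.trunc N f - SymL2.trunc M g)‖ ^ 2 := by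
  obtain ⟨C, hC0, hC⟩ := exists_lipschitz_klOp hL (16 * ρ ^ 2)
  refine ⟨C, hC0, fun N M f g hf hg => ?_⟩
  have hUN := isSmooth_truncField s ε N f
  have hUM := isSmooth_truncField s ε M g
  have h3N : Torus.latNormSq 3 (truncField s ε N f) ≤ 16 * ρ ^ 2 :=
    (latNormSq_three_truncField_le s ε N f).trans (mul_le_mul_of_nonneg_left (pow_le_pow_left₀ (norm_nonneg _) hf 2) (by norm_num))
  have h3M : Torus.latNormSq 3 (truncField s ε M g) ≤ 16 * ρ ^ 2 :=
    (latNormSq_three_truncField_le s ε M g).trans (mul_le_mul_of_nonneg_left (pow_le_pow_left₀ (norm_nonneg _) hg 2) (by norm_num))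
  have key := hC _ _ hUN hUM h3N h3M
  rw [klOpApprox, klOpApprox, norm_toL2_sub_sq]
  refine key.trans (le_of_eq ?_)
  congr 1
  -- `lat₂` of the difference of the truncated fields
  have h := latNormSq_two_eq_norm_diag_sq s ε (hUN.sub hUM)
  have e : toSym s ε (hUN.sub hUM) = SymL2.trunc N f - SymL2.trunc M g := by
    rw [show toSym s ε (hUN.sub hUM) = toSym s ε hUN - toSym s ε hUM from
      ofSmooth_fun_sub (isWeight_klWeight s ε) (polyGrowth_klWeight s ε) hUN hUM, toSym_truncField, toSym_truncField]
  rw [e] at h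
  exact h

/-- The approximants are Cauchy. [folklore] -/
theorem cauchySeq_klOpApprox (f : SymL2 (Fin 3)) : CauchySeq fun N => klOpApprox hL s ε N f := by
  obtain ⟨C, hC0, hC⟩ := exists_norm_klOpApprox_sub_sq_le hL s ε ‖f‖
  set D := SymL2.diag (h2Symbol s ε) (abs_h2Symbol_le s ε) (h2Symbol_neg s ε) with hD
  -- `trunc N f → f`, hence `D (trunc N f)` is Cauchy
  have ht : Tendsto (fun N => D (SymL2.trunc N f)) atTop (𝓝 (D f)) := (D.continuous.tendsto f).comp (SymL2.tendsto_trunc f)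
  have hc : CauchySeq fun N => D (SymL2.trunc N f) := ht.cauchySeq
  rw [Metric.cauchySeq_iff] at hc ⊢
  intro δ hδ
  have hδ' : 0 < δ ^ 2 / (C + 1) := by positivity
  obtain ⟨N₀, hN₀⟩ := hc (Real.sqrt (δ ^ 2 / (C + 1))) (Real.sqrt_pos.2 hδ')
  refine ⟨N₀, fun N hN M hM => ?_⟩
  have h1 := hC N M f f le_rfl le_rfl
  rw [map_sub] at h1
  have h2 := hN₀ N hN M hM
  rw [dist_eq_norm] at h2 ⊢
  have h3 : ‖D (SymL2.trunc N f) - D (SymL2.trunc M f)‖ ^ 2 < δ ^ 2 / (C + 1) := by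
    have := pow_lt_pow_left₀ h2 (norm_nonneg _) two_ne_zero
    rwa [Real.sq_sqrt hδ'.le] at this
  have h4 : ‖klOpApprox hL s ε N f - klOpApprox hL s ε M f‖ ^ 2 < δ ^ 2 := by
    calc _ ≤ C * ‖D (SymL2.trunc N f) - D (SymL2.trunc M f)‖ ^ 2 := h1
      _ ≤ (C + 1) * ‖D (SymL2.trunc N f) - D (SymL2.trunc M f)‖ ^ 2 := mul_le_mul_of_nonneg_right (by linarith) (sq_nonneg _)
      _ < (C + 1) * (δ ^ 2 / (C + 1)) := mul_lt_mul_of_pos_left h3 (by linarith)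
      _ = δ ^ 2 := by field_simp
  exact (pow_lt_pow_iff_left₀ (norm_nonneg _) hδ.le two_ne_zero).1 h4

/-- **The extended operator** `𝒜̂ f = lim_N 𝒜̂_N f` on all of `SymL2`. [cite: KatoLai1984, §5 (5.6)] -/
def klOpExt (f : SymL2 (Fin 3)) : SymL2 (Fin 3) := limUnder atTop fun N => klOpApprox hL s ε N f

/-- The approximants converge to the extended operator. [folklore] -/
theorem tendsto_klOpApprox (f : SymL2 (Fin 3)) : Tendsto (fun N => klOpApprox hL s ε N f) atTop (𝓝 (klOpExt hL s ε f)) :=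
  (cauchySeq_klOpApprox hL s ε f).tendsto_limUnder

/-- **(E2) The local Lipschitz bound of the extended operator**: for `‖f‖, ‖g‖ ≤ ρ`,
`‖𝒜̂ f − 𝒜̂ g‖² ≤ C_ρ ‖diag h2 (f − g)‖²`. [cite: KatoLai1984, §5] -/
theorem exists_norm_klOpExt_sub_sq_le (ρ : ℝ) : ∃ C : ℝ, 0 ≤ C ∧
    ∀ (f g : SymL2 (Fin 3)), ‖f‖ ≤ ρ → ‖g‖ ≤ ρ →
      ‖klOpExt hL s ε f - klOpExt hL s ε g‖ ^ 2 ≤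
        C * ‖SymL2.diag (h2Symbol s ε) (abs_h2Symbol_le s ε) (h2Symbol_neg s ε) (f - g)‖ ^ 2 := by
  obtain ⟨C, hC0, hC⟩ := exists_norm_klOpApprox_sub_sq_le hL s ε ρ
  refine ⟨C, hC0, fun f g hf hg => ?_⟩
  set D := SymL2.diag (h2Symbol s ε) (abs_h2Symbol_le s ε) (h2Symbol_neg s ε) with hD
  have hlhs : Tendsto (fun N => ‖klOpApprox hL s ε N f - klOpApprox hL s ε N g‖ ^ 2) atTop
      (𝓝 (‖klOpExt hL s ε f - klOpExt hL s ε g‖ ^ 2)) :=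
    (((tendsto_klOpApprox hL s ε f).sub (tendsto_klOpApprox hL s ε g)).norm).pow 2
  have hrhs : Tendsto (fun N => C * ‖D (SymL2.trunc N f - SymL2.trunc N g)‖ ^ 2) atTop (𝓝 (C * ‖D (f - g)‖ ^ 2)) := by
    have ht : Tendsto (fun N => SymL2.trunc N f - SymL2.trunc N g) atTop (𝓝 (f - g)) := (SymL2.tendsto_trunc f).sub (SymL2.tendsto_trunc g)
    exact (((D.continuous.tendsto _).comp ht).norm.pow 2).const_mul C
  exact le_of_tendsto_of_tendsto' hlhs hrhs fun N => hC N N f g hf hg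

/-- `‖diag h2 g‖ ≤ 4 ‖g‖`. [folklore] -/
theorem norm_diag_h2_le (g : SymL2 (Fin 3)) :
    ‖SymL2.diag (h2Symbol s ε) (abs_h2Symbol_le s ε) (h2Symbol_neg s ε) g‖ ≤ 4 * ‖g‖ :=
  SymL2.norm_diag_le (h2Symbol s ε) (abs_h2Symbol_le s ε) (h2Symbol_neg s ε) g

/-- The extended operator is continuous on `SymL2`. [folklore] -/
theorem continuous_klOpExt : Continuous (klOpExt hL s ε) := by
  rw [Metric.continuous_iff]
  intro g δ hδ
  obtain ⟨C, hC0, hC⟩ := exists_norm_klOpExt_sub_sq_le hL s ε (‖g‖ + 1)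
  refine ⟨min 1 (δ / (4 * Real.sqrt (C + 1))), lt_min one_pos (by positivity), fun f hf => ?_⟩
  rw [dist_eq_norm] at hf ⊢
  have hf1 : ‖f - g‖ < 1 := hf.trans_le (min_le_left _ _)
  have hf2 : ‖f - g‖ < δ / (4 * Real.sqrt (C + 1)) := hf.trans_le (min_le_right _ _)
  have hfn : ‖f‖ ≤ ‖g‖ + 1 := by
    have := norm_add_le (f - g) g
    rw [sub_add_cancel] at this
    linarith
  have hgn : ‖g‖ ≤ ‖g‖ + 1 := by linarith
  have h1 := hC f g hfn hgn
  have h2 := norm_diag_h2_le s ε (f - g)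
  have hsq : ‖klOpExt hL s ε f - klOpExt hL s ε g‖ ^ 2 < δ ^ 2 := by
    have hpos : 0 < 4 * Real.sqrt (C + 1) := by positivity
    have h3 : ‖f - g‖ * (4 * Real.sqrt (C + 1)) < δ := (lt_div_iff₀ hpos).1 hf2
    have hs : Real.sqrt (C + 1) ^ 2 = C + 1 := Real.sq_sqrt (by linarith)
    calc ‖klOpExt hL s ε f - klOpExt hL s ε g‖ ^ 2
        ≤ C * ‖SymL2.diag (h2Symbol s ε) (abs_h2Symbol_le s ε) (h2Symbol_neg s ε) (f - g)‖ ^ 2 := h1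
      _ ≤ C * (4 * ‖f - g‖) ^ 2 := mul_le_mul_of_nonneg_left (pow_le_pow_left₀ (norm_nonneg _) h2 2) hC0
      _ ≤ (C + 1) * (4 * ‖f - g‖) ^ 2 := mul_le_mul_of_nonneg_right (by linarith) (sq_nonneg _)
      _ = (‖f - g‖ * (4 * Real.sqrt (C + 1))) ^ 2 := by rw [mul_pow, mul_pow, mul_pow, hs]; ring
      _ < δ ^ 2 := pow_lt_pow_left₀ h3 (by positivity) two_ne_zero
  exact (pow_lt_pow_iff_left₀ (norm_nonneg _) hδ.le two_ne_zero).1 hsq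

/-- **(E1) On smooth fields the extended operator is the operator**:
`𝒜̂ (toSym U) = toL2 (klOp U)`. [cite: KatoLai1984, §5 (5.6)] -/
theorem klOpExt_toSym {U : UnitAddTorus (Fin 3) → ℝ³} (hU : IsSmooth U) :
    klOpExt hL s ε (toSym s ε hU) = toL2 (isSmooth_klOp hL hU) := by
  set f := toSym s ε hU with hf
  obtain ⟨C, hC0, hC⟩ := exists_lipschitz_klOp hL (16 * ‖f‖ ^ 2)
  set D := SymL2.diag (h2Symbol s ε) (abs_h2Symbol_le s ε) (h2Symbol_neg s ε) with hD
  refine tendsto_nhds_unique (tendsto_klOpApprox hL s ε f) ?_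
  -- `‖𝒜̂_N f − toL2 (klOp U)‖² ≤ C ‖D (trunc N f − f)‖² → 0`
  have hbound : ∀ N, ‖klOpApprox hL s ε N f - toL2 (isSmooth_klOp hL hU)‖ ^ 2 ≤ C * ‖D (SymL2.trunc N f - f)‖ ^ 2 := by
    intro N
    have hUN := isSmooth_truncField s ε N f
    have h3N : Torus.latNormSq 3 (truncField s ε N f) ≤ 16 * ‖f‖ ^ 2 := latNormSq_three_truncField_le s ε N f
    have h3 : Torus.latNormSq 3 U ≤ 16 * ‖f‖ ^ 2 := latNormSq_three_le_norm_toSym_sq s ε hU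
    have key := hC _ _ hUN hU h3N h3
    rw [klOpApprox, norm_toL2_sub_sq]
    refine key.trans (le_of_eq ?_)
    congr 1
    have h := latNormSq_two_eq_norm_diag_sq s ε (hUN.sub hU)
    rw [show toSym s ε (hUN.sub hU) = toSym s ε hUN - toSym s ε hU from
      ofSmooth_fun_sub (isWeight_klWeight s ε) (polyGrowth_klWeight s ε) hUN hU, toSym_truncField] at h
    exact h
  have hD0 : Tendsto (fun N => C * ‖D (SymL2.trunc N f - f)‖ ^ 2) atTop (𝓝 0) := by
    have ht : Tendsto (fun N => SymL2.trunc N f - f) atTop (𝓝 0) := by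
      have := (SymL2.tendsto_trunc f).sub (tendsto_const_nhds (x := f))
      rwa [sub_self] at this
    have := (((D.continuous.tendsto _).comp ht).norm.pow 2).const_mul C
    simpa using this
  rw [tendsto_iff_norm_sub_tendsto_zero]
  have hsq : Tendsto (fun N => ‖klOpApprox hL s ε N f - toL2 (isSmooth_klOp hL hU)‖ ^ 2) atTop (𝓝 0) :=
    squeeze_zero (fun N => sq_nonneg _) hbound hD0
  have := hsq.sqrt
  simpa [Real.sqrt_sq (norm_nonneg _)] using this

/-- **(E3) Weakly convergent sequences are mapped to norm convergent ones** ("weak convergence in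
`H^{s₀−1}` implies local uniform convergence"). [cite: KatoLai1984, §5] -/
theorem tendsto_klOpExt_of_weakTendsto {f : ℕ → SymL2 (Fin 3)} {g : SymL2 (Fin 3)} (hf : SymL2.WeakTendsto f g) :
    Tendsto (fun n => klOpExt hL s ε (f n)) atTop (𝓝 (klOpExt hL s ε g)) := by
  obtain ⟨R, hR0, hR⟩ := hf.exists_norm_le
  set ρ := max R ‖g‖ with hρ
  obtain ⟨C, hC0, hC⟩ := exists_norm_klOpExt_sub_sq_le hL s ε ρ
  set D := SymL2.diag (h2Symbol s ε) (abs_h2Symbol_le s ε) (h2Symbol_neg s ε) with hD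
  have hDt : Tendsto (fun n => D (f n)) atTop (𝓝 (D g)) :=
    hf.tendsto_diag_of_vanishing (abs_h2Symbol_le s ε) (h2Symbol_neg s ε) (vanishingSymbol_h2Symbol s ε)
  have hbound : ∀ n, ‖klOpExt hL s ε (f n) - klOpExt hL s ε g‖ ^ 2 ≤ C * ‖D (f n) - D g‖ ^ 2 := fun n => by
    rw [← map_sub]
    exact hC (f n) g ((hR n).trans (le_max_left _ _)) (le_max_right _ _)
  have hD0 : Tendsto (fun n => C * ‖D (f n) - D g‖ ^ 2) atTop (𝓝 0) := by
    have := ((tendsto_iff_norm_sub_tendsto_zero.1 hDt).pow 2).const_mul C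
    simpa using this
  rw [tendsto_iff_norm_sub_tendsto_zero]
  have hsq : Tendsto (fun n => ‖klOpExt hL s ε (f n) - klOpExt hL s ε g‖ ^ 2) atTop (𝓝 0) :=
    squeeze_zero (fun n => sq_nonneg _) hbound hD0
  have := hsq.sqrt
  simpa [Real.sqrt_sq (norm_nonneg _)] using this

end Ext

end PeriodicCylinder

end Literature.Analysis.FluidPDE
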